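import Summits.ResolutionOfSingularities.ResolutionOfSingularities.Theorems.HomologicalConductorNoZenoThreadRational
import Summits.ResolutionOfSingularities.ResolutionOfSingularities.Theorems.SyzygyFlatteningHigherRankTerminationEssFiniteType
import Literature.AlgebraicGeometry.Resolution.IntegralClosureEssFiniteType
import HarnessLib

/-!
# Crux `NoZenoR` / `NoZeno` (stmt-ResolutionOfSingularities-19943 / -16483), registered stub `stub_L1wCore` (v25–v28):
# the RATIONALITY conjunct of the thread-free sandwich step, in the EXACT binder shape of `Sig.L1Core`

OURS (cell res-hironaka, chain W4.4; stub worker res-L0-w44-stub-2 g11; brick plan `L1W-PREP.md` 4a61d05beab993ff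
STEP 4 «D′ rational», now by the registered binders of res-L0-w44-lead-1's `Beta2Descent.Sig.L1Core`
(`L/res-L0-w44-lead-1/L1wCore.lean` acd54dc8e998b215, registry v28 d5a17e95d32a4700)).  Nothing here is a statement
of the manuscript under review; AI-written, weaker than expert review.

`Sig.L1Core 𝓜 𝓢` concludes `IsRegularLocalRing D' ∨ (HasRationalSingularity D' ∧ 𝓜 D' (N − 1))` for
`D := locPrime T P` (a two-dimensional RATIONAL germ, `T` essentially of finite type over `k`, normal, `Frac T = K`),
`B := k[D ∪ C·x⁻¹]` (the `x`-chart of the blow-up of `D` along the `𝔪_D`-primary ideal spanned by `C ⊆ T`) and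
`D' := (nrm B)_𝔮 ⊇ D` normal of dimension two.  This file proves, for EVERY measure `𝓜` and with no sandwich
hypothesis, the conjunct **`HasRationalSingularity D'`** modulo the named fact `Lipman1969_1_2` only:

* `essFiniteType_blowupChart` — `B = k[D ∪ C·x⁻¹]` is essentially of finite type over `k`: the `D`-module `D·C·x⁻¹`
  is generated by finitely many `cᵢ·x⁻¹` (`D` Noetherian), so `B = D[c₁x⁻¹, …, c_r x⁻¹]`
  (`Literature…essFiniteType_adjoin`);
* `L1Core_hasRationalSingularity` — the rationality conjunct, from RAT-STEP
  (`Thread.hasRationalSingularity_locPrime_of_le`, p530554) with `T' := nrm B` essentially of finite type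
  (`stub_essFiniteType_nrm`, tree) and `Frac B = K`.
-/

noncomputable section

-- single-problem summit: the doubled namespace component `ResolutionOfSingularities` is forced
set_option linter.dupNamespace false

namespace Summit.ResolutionOfSingularities.ResolutionOfSingularities.Theorems.NoZeno.SandwichCluster.Thread

open IsLocalRing
open Literature.AlgebraicGeometry.Resolution
open Summit.ResolutionOfSingularities.ResolutionOfSingularities.Theses.HomologicalConductor
open Summit.ResolutionOfSingularities.ResolutionOfSingularities.Theorems.NoZeno.Birth

variable {k K : Type} [Field k] [Field K] [Algebra k K]

/-- **The blow-up chart `k[D ∪ C·x⁻¹]` of a germ `D = T_P` is essentially of finite type over `k`** (`T`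
essentially of finite type over `k`, `C ⊆ T` any set, `x ∈ K`): the ideal of the Noetherian `D` spanned by `C` is
generated by a finite `F₀ ⊆ C`, and `k[D ∪ C·x⁻¹] = D[F₀·x⁻¹]`. [this work] -/
theorem essFiniteType_blowupChart (T : Subalgebra k K) [Algebra.EssFiniteType k ↥T] (P : Ideal ↥T) (hP : P.IsPrime)
    (C : Set K) (hC : C ⊆ (T : Set K)) (x : K) (B : Subalgebra k K)
    (hB : B = Algebra.adjoin k ((Parasite.locPrime T P hP : Set K) ∪ {y : K | ∃ c ∈ C, y = c * x⁻¹})) :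
    Algebra.EssFiniteType k ↥B := by
  classical
  haveI := hP
  set D := Parasite.locPrime T P hP with hD
  -- `D` as a `k`-algebra inside `K`, essentially of finite type (a localisation of `T`), Noetherian
  haveI : IsNoetherianRing ↥T := Algebra.EssFiniteType.isNoetherianRing k ↥T
  letI algTD : Algebra ↥T ↥D := (Subring.inclusion (toSubring_le_locPrime T P hP)).toAlgebra
  haveI := isLocalization_locPrime T P hP
  letI algDK : Algebra ↥D K := D.subtype.toAlgebra
  letI algkD : Algebra k ↥D :=
    (RingHom.codRestrict (algebraMap k K) D fun c => toSubring_le_locPrime T P hP (algebraMap k ↥T c).2).toAlgebra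
  haveI : IsScalarTower k ↥T ↥D := IsScalarTower.of_algebraMap_eq fun _ => Subtype.ext rfl
  haveI : IsScalarTower k ↥D K := IsScalarTower.of_algebraMap_eq fun _ => rfl
  haveI : Algebra.EssFiniteType ↥T ↥D := Algebra.EssFiniteType.of_isLocalization _ P.primeCompl
  haveI : Algebra.EssFiniteType k ↥D := Algebra.EssFiniteType.comp k ↥T ↥D
  haveI : IsNoetherianRing ↥D := IsLocalization.isNoetherianRing P.primeCompl _ inferInstance
  -- a finite generating subset `F₀ ⊆ {d ∈ D | d ∈ C}` of the ideal spanned by `C`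
  obtain ⟨F₀, hF₀C, hspan⟩ := (Submodule.fg_span_iff_fg_span_finset_subset
    (R := ↥D) (M := ↥D) {d : ↥D | (d : K) ∈ C}).mp (IsNoetherian.noetherian _)
  -- the finite set of chart generators and the `D`-algebra they generate
  let F : Finset K := F₀.image (fun d : ↥D => ((d : K) * x⁻¹))
  have hEF : Algebra.EssFiniteType k ↥(Algebra.adjoin ↥D (F : Set K)) :=
    essFiniteType_adjoin (k := k) (A := ↥D) (K := K) F
  -- `B` and `D[F]` have the same underlying set
  set S : Subalgebra k K := (Algebra.adjoin ↥D (F : Set K)).restrictScalars k with hS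
  have hle₁ : B ≤ S := by
    rw [hB]
    refine Algebra.adjoin_le ?_
    rintro y (hy | ⟨c, hcC, rfl⟩)
    · change y ∈ Algebra.adjoin ↥D (F : Set K)
      exact Subalgebra.algebraMap_mem (Algebra.adjoin ↥D (F : Set K)) (⟨y, hy⟩ : ↥D)
    · -- `c ∈ C ⊆ T ⊆ D`, and `{d ∈ D | d·x⁻¹ ∈ D[F]}` is an ideal containing `F₀`, hence the span
      change c * x⁻¹ ∈ Algebra.adjoin ↥D (F : Set K)
      have hcD : c ∈ D := toSubring_le_locPrime T P hP (hC hcC)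
      let φ : ↥D →ₗ[↥D] K :=
        { toFun := fun d => (d : K) * x⁻¹
          map_add' := fun a b => by push_cast; ring
          map_smul' := fun a b => by
            change ((a * b : ↥D) : K) * x⁻¹ = (a : K) * ((b : K) * x⁻¹)
            push_cast; ring }
      let M : Submodule ↥D ↥D := (Subalgebra.toSubmodule (Algebra.adjoin ↥D (F : Set K))).comap φ
      have hF₀M : (F₀ : Set ↥D) ⊆ M := by
        intro d hd
        change ((d : ↥D) : K) * x⁻¹ ∈ Algebra.adjoin ↥D (F : Set K)
        refine Algebra.subset_adjoin ?_
        rw [Finset.mem_coe, Finset.mem_image]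
        exact ⟨d, hd, rfl⟩
      have hcspan : (⟨c, hcD⟩ : ↥D) ∈ Submodule.span ↥D ({d : ↥D | (d : K) ∈ C}) :=
        Submodule.subset_span (by exact hcC)
      rw [hspan] at hcspan
      have hcM : (⟨c, hcD⟩ : ↥D) ∈ M := (Submodule.span_le.mpr hF₀M) hcspan
      exact hcM
  have hle₂ : S ≤ B := by
    -- `B` contains `D` and `F`, and is closed under the `D`-algebra operations
    let B' : Subalgebra ↥D K :=
      { B with
        algebraMap_mem' := fun d => by
          change (d : K) ∈ B
          rw [hB]
          exact Algebra.subset_adjoin (Or.inl d.2) }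
    have hB' : Algebra.adjoin ↥D (F : Set K) ≤ B' := by
      refine Algebra.adjoin_le ?_
      intro y hy
      rw [Finset.mem_coe, Finset.mem_image] at hy
      obtain ⟨d, hd, rfl⟩ := hy
      change ((d : ↥D) : K) * x⁻¹ ∈ B
      rw [hB]
      have hdC : ((d : ↥D) : K) ∈ C := hF₀C (Finset.mem_coe.mpr hd)
      exact Algebra.subset_adjoin (Or.inr ⟨((d : ↥D) : K), hdC, rfl⟩)
    intro y hy
    exact hB' hy
  have heq : S = B := le_antisymm hle₂ hle₁
  -- transport `EssFiniteType` along the equality of subalgebras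
  haveI : Algebra.EssFiniteType k ↥S := hEF
  have e : ↥S ≃ₐ[k] ↥B := Subalgebra.equivOfEq _ _ heq
  exact Algebra.EssFiniteType.of_surjective e.toAlgHom e.surjective

/-- **The rationality conjunct of `stub_L1wCore`, for every measure** (binders VERBATIM from
`Beta2Descent.Sig.L1Core` — `T`, `P`, ess. finite type, `T` normal, `Frac T = K`, `dim D = 2`, `D` rational, `C ⊆ T`,
`x`, `B`, `𝔮`, `D'`, `D ⊆ D'`, `dim D' = 2`, `D'` normal — minus `𝓜`, `𝓢`, `N`, `x ∈ C`, `x ≠ 0` and the radical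
hypothesis, which are not needed): the next germ
`D' = (nrm k[D ∪ C·x⁻¹])_𝔮 ⊇ D` — normal of dimension two over the two-dimensional rational germ `D = T_P` — has a
rational singularity.  Modulo Lipman's (1.2) only (`h12`). [cite: Lipman1969, Proposition (1.2) 1) (p. 199)] -/
theorem L1Core_hasRationalSingularity (h12 : Lipman1969_1_2.{0}) (T : Subalgebra k K) (P : Ideal ↥T)
    (hP : P.IsPrime) (hET : Algebra.EssFiniteType k ↥T) (hTIC : IsIntegrallyClosed ↥T) (hfr : IsFractionRing ↥T K)
    (hdim : ringKrullDim ↥(Parasite.locPrime T P hP) = 2)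
    (hrat : HasRationalSingularity ↥(Parasite.locPrime T P hP))
    (C : Set K) (hC : C ⊆ (T : Set K)) (x : K) (B : Subalgebra k K)
    (hB : B = Algebra.adjoin k ((Parasite.locPrime T P hP : Set K) ∪ {y : K | ∃ c ∈ C, y = c * x⁻¹}))
    (𝔮 : Ideal ↥(nrm B)) (h𝔮 : 𝔮.IsPrime) (D' : Subring K)
    (hD' : Parasite.locPrime (nrm B) 𝔮 h𝔮 = D') (hle : (Parasite.locPrime T P hP : Set K) ⊆ D')
    (hdim' : ringKrullDim ↥D' = 2) (hIC' : IsIntegrallyClosed ↥D') :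
    HasRationalSingularity ↥D' := by
  subst hD'
  haveI := hP
  haveI := hET
  haveI := hfr
  haveI : IsNoetherianRing ↥T := Algebra.EssFiniteType.isNoetherianRing k ↥T
  -- `B` is an affine model of `K`, essentially of finite type; hence so is `nrm B`
  have hTB : T ≤ B := by
    intro y hy
    rw [hB]
    exact Algebra.subset_adjoin (Or.inl (toSubring_le_locPrime T P hP hy))
  haveI : IsFractionRing ↥B K := Literature.AlgebraicGeometry.Resolution.isFractionRing_subalgebra_of_le T B hTB
  haveI : Algebra.EssFiniteType k ↥B := essFiniteType_blowupChart T P hP C hC x B hB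
  haveI : Algebra.EssFiniteType k ↥(nrm B) := SyzygyFlattening.stub_essFiniteType_nrm k K B inferInstance inferInstance
  -- `D` is Noetherian and normal (a prime localisation of `T`)
  have hN : IsNoetherianRing ↥(Parasite.locPrime T P hP) := by
    letI : Algebra ↥T ↥(Parasite.locPrime T P hP) := (Subring.inclusion (toSubring_le_locPrime T P hP)).toAlgebra
    haveI := isLocalization_locPrime T P hP
    exact IsLocalization.isNoetherianRing P.primeCompl _ inferInstance
  have hIC : IsIntegrallyClosed ↥(Parasite.locPrime T P hP) := by
    haveI := hTIC
    exact isIntegrallyClosed_locPrime T P hP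
  exact hasRationalSingularity_locPrime_of_le h12 T (nrm B) P hP 𝔮 h𝔮 (fun y hy => hle hy) hN hIC hdim hrat
    hIC' hdim'

end Summit.ResolutionOfSingularities.ResolutionOfSingularities.Theorems.NoZeno.SandwichCluster.Thread

end
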